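import Summits.Parity.GeneralizedHardyLittlewood.Theorems.FordMaynardNoSieveConst0164NegWitness0164SectionMomentsOuter
import Summits.Parity.GeneralizedHardyLittlewood.Theorems.FordMaynardNoSieveConst0164NegWitness0164SectionMomentsRaw

/-!
# Route `FordMaynardNoSieveConst0164`, crux `NegWitness0164` (stmt-Parity-19102), line `birth`,
# stub `stub_tweakNeg0164`: enclosure layer — section moments of the unit box, closed forms (C)

Helper file toward the certificate stub (K. Ford, J. Maynard, *On the theory of prime producing sieves*,
arXiv:2407.14368, §8).  Closed forms of the section moments
`M_{abc}(s) = ∫_{Δ₃(s)} 𝟙[u ∈ (0,1)³] u₀^a u₁^b u₂^c` (projection measure) on the ranges `s ∈ (0,1]`, `[1,2)`, `[2,3]`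
for the exponent triples (0,2,2), (1,0,0), (1,0,1), (1,0,2), assembled from `sectionMoment_peel_0164`, the inner closed forms and the outer range lemmas
(`…SectionMomentsPeel`, `…SectionMomentsOuter`) and the polynomial antiderivatives proved here.  These are the
coefficients of the piecewise-polynomial upper bounds of the α-families of (II') (`cell_integral_le_unitbox_0164`);
the values agree with the exact table in this hand's census (scripts/n3_moments.json), e.g. `M_{000} = ` Irwin–Hall.

Def-free.  References: [FordMaynard2024PrimeSieves] arXiv:2407.14368, §8 (proof of Theorem 2.7 (c)); folklore calculus.
-/

noncomputable section

open Finset MeasureTheory Set intervalIntegral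
open scoped Classical
open Literature.NumberTheory.Sieve Literature.NumberTheory.Sieve.FordMaynard

namespace Summit.Parity.GeneralizedHardyLittlewood.FordMaynardNoSieveConst0164NegWitness0164

/-- Polynomial antiderivative (generated): `∫ t^2·P(s−t)` for `P = (1 / 3 : ℝ) * r ^ 3`. [folklore] -/
theorem outerInt_low_0_2_2_0164 (s lo hi : ℝ) :
    (∫ t in lo..hi, t ^ 2 * ((1 / 3 : ℝ) * (s - t) ^ 3)) =
      (((1 / 3 : ℝ) * s ^ 3) * hi ^ 3 / 3 + ((-1 : ℝ) * s ^ 2) * hi ^ 4 / 4 + ((1 : ℝ) * s) * hi ^ 5 / 5 + ((-(1 / 3) : ℝ)) * hi ^ 6 / 6) -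
      (((1 / 3 : ℝ) * s ^ 3) * lo ^ 3 / 3 + ((-1 : ℝ) * s ^ 2) * lo ^ 4 / 4 + ((1 : ℝ) * s) * lo ^ 5 / 5 + ((-(1 / 3) : ℝ)) * lo ^ 6 / 6) := by
  have hderiv : ∀ t : ℝ, HasDerivAt (fun t : ℝ => ((1 / 3 : ℝ) * s ^ 3) * t ^ 3 / 3 + ((-1 : ℝ) * s ^ 2) * t ^ 4 / 4 + ((1 : ℝ) * s) * t ^ 5 / 5 + ((-(1 / 3) : ℝ)) * t ^ 6 / 6)
      (t ^ 2 * ((1 / 3 : ℝ) * (s - t) ^ 3)) t := by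
    intro t
    have h0 := ((hasDerivAt_pow 3 t).const_mul ((1 / 3 : ℝ) * s ^ 3)).div_const (3 : ℝ)
    have h1 := ((hasDerivAt_pow 4 t).const_mul ((-1 : ℝ) * s ^ 2)).div_const (4 : ℝ)
    have h2 := ((hasDerivAt_pow 5 t).const_mul ((1 : ℝ) * s)).div_const (5 : ℝ)
    have h3 := ((hasDerivAt_pow 6 t).const_mul ((-(1 / 3) : ℝ))).div_const (6 : ℝ)
    refine (((((h0.add h1).add h2).add h3).congr_of_eventuallyEq ?_).congr_deriv ?_)
    · exact Filter.Eventually.of_forall fun y => by simp only [Pi.add_apply]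
    · push_cast; try ring
  rw [intervalIntegral.integral_eq_sub_of_hasDerivAt (fun t _ => hderiv t)
    ((by fun_prop : Continuous fun t : ℝ => t ^ 2 * ((1 / 3 : ℝ) * (s - t) ^ 3)).intervalIntegrable _ _)]

/-- Polynomial antiderivative (generated): `∫ t^2·P(s−t)` for `P = (2 / 3 : ℝ) + (-1 : ℝ) * r + (1 : ℝ) * r ^ 2 + (-(1 / 3) : ℝ) * r ^ 3`. [folklore] -/
theorem outerInt_high_0_2_2_0164 (s lo hi : ℝ) :
    (∫ t in lo..hi, t ^ 2 * ((2 / 3 : ℝ) + (-1 : ℝ) * (s - t) + (1 : ℝ) * (s - t) ^ 2 + (-(1 / 3) : ℝ) * (s - t) ^ 3)) =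
      (((2 / 3 : ℝ) + (-1 : ℝ) * s + (1 : ℝ) * s ^ 2 + (-(1 / 3) : ℝ) * s ^ 3) * hi ^ 3 / 3 + ((1 : ℝ) + (-2 : ℝ) * s + (1 : ℝ) * s ^ 2) * hi ^ 4 / 4 + ((1 : ℝ) + (-1 : ℝ) * s) * hi ^ 5 / 5 + ((1 / 3 : ℝ)) * hi ^ 6 / 6) -
      (((2 / 3 : ℝ) + (-1 : ℝ) * s + (1 : ℝ) * s ^ 2 + (-(1 / 3) : ℝ) * s ^ 3) * lo ^ 3 / 3 + ((1 : ℝ) + (-2 : ℝ) * s + (1 : ℝ) * s ^ 2) * lo ^ 4 / 4 + ((1 : ℝ) + (-1 : ℝ) * s) * lo ^ 5 / 5 + ((1 / 3 : ℝ)) * lo ^ 6 / 6) := by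
  have hderiv : ∀ t : ℝ, HasDerivAt (fun t : ℝ => ((2 / 3 : ℝ) + (-1 : ℝ) * s + (1 : ℝ) * s ^ 2 + (-(1 / 3) : ℝ) * s ^ 3) * t ^ 3 / 3 + ((1 : ℝ) + (-2 : ℝ) * s + (1 : ℝ) * s ^ 2) * t ^ 4 / 4 + ((1 : ℝ) + (-1 : ℝ) * s) * t ^ 5 / 5 + ((1 / 3 : ℝ)) * t ^ 6 / 6)
      (t ^ 2 * ((2 / 3 : ℝ) + (-1 : ℝ) * (s - t) + (1 : ℝ) * (s - t) ^ 2 + (-(1 / 3) : ℝ) * (s - t) ^ 3)) t := by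
    intro t
    have h0 := ((hasDerivAt_pow 3 t).const_mul ((2 / 3 : ℝ) + (-1 : ℝ) * s + (1 : ℝ) * s ^ 2 + (-(1 / 3) : ℝ) * s ^ 3)).div_const (3 : ℝ)
    have h1 := ((hasDerivAt_pow 4 t).const_mul ((1 : ℝ) + (-2 : ℝ) * s + (1 : ℝ) * s ^ 2)).div_const (4 : ℝ)
    have h2 := ((hasDerivAt_pow 5 t).const_mul ((1 : ℝ) + (-1 : ℝ) * s)).div_const (5 : ℝ)
    have h3 := ((hasDerivAt_pow 6 t).const_mul ((1 / 3 : ℝ))).div_const (6 : ℝ)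
    refine (((((h0.add h1).add h2).add h3).congr_of_eventuallyEq ?_).congr_deriv ?_)
    · exact Filter.Eventually.of_forall fun y => by simp only [Pi.add_apply]
    · push_cast; try ring
  rw [intervalIntegral.integral_eq_sub_of_hasDerivAt (fun t _ => hderiv t)
    ((by fun_prop : Continuous fun t : ℝ => t ^ 2 * ((2 / 3 : ℝ) + (-1 : ℝ) * (s - t) + (1 : ℝ) * (s - t) ^ 2 + (-(1 / 3) : ℝ) * (s - t) ^ 3)).intervalIntegrable _ _)]

/-- **`M_{022}(s)` on `(0,1]`.** [folklore] -/
theorem sectionMoment_0_2_2_one_0164 {s : ℝ} (hs0 : 0 < s) (hs1 : s ≤ 1) :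
    sliceIntegral 3 s (fun u : Fin 3 → ℝ => if ∀ k, 0 < u k ∧ u k < 1 then u 0 ^ 0 * u 1 ^ 2 * u 2 ^ 2 else 0) =
      (1 / 180 : ℝ) * s ^ 6 := by
  rw [sectionMoment_peel_0164]
  have h := outer_range_one_0164 2 hs0 hs1 (fun r : ℝ => ∫ x in Set.Ioo 0 r, (if (0 < x ∧ x < 1) ∧ (0 < r - x ∧ r - x < 1) then x ^ 0 * (r - x) ^ 2 else 0)) (fun r : ℝ => (1 / 3 : ℝ) * r ^ 3)
    (fun r hr0 hr1 => innerMomentRaw_low_0_2_0164 hr0 hr1)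
  beta_reduce at h
  rw [h, outerInt_low_0_2_2_0164]
  ring

/-- **`M_{022}(s)` on `[1,2)`.** [folklore] -/
theorem sectionMoment_0_2_2_two_0164 {s : ℝ} (hs1 : 1 ≤ s) (hs2 : s < 2) :
    sliceIntegral 3 s (fun u : Fin 3 → ℝ => if ∀ k, 0 < u k ∧ u k < 1 then u 0 ^ 0 * u 1 ^ 2 * u 2 ^ 2 else 0) =
      (-(7 / 60) : ℝ) + (13 / 30 : ℝ) * s + (-(7 / 12) : ℝ) * s ^ 2 + (1 / 3 : ℝ) * s ^ 3 + (-(1 / 12) : ℝ) * s ^ 4 + (1 / 30 : ℝ) * s ^ 5 + (-(1 / 90) : ℝ) * s ^ 6 := by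
  rw [sectionMoment_peel_0164]
  have h := outer_range_two_0164 2 hs1 hs2 (fun r : ℝ => ∫ x in Set.Ioo 0 r, (if (0 < x ∧ x < 1) ∧ (0 < r - x ∧ r - x < 1) then x ^ 0 * (r - x) ^ 2 else 0)) (fun r : ℝ => (1 / 3 : ℝ) * r ^ 3) (fun r : ℝ => (2 / 3 : ℝ) + (-1 : ℝ) * r + (1 : ℝ) * r ^ 2 + (-(1 / 3) : ℝ) * r ^ 3)
    (fun r hr0 hr1 => innerMomentRaw_low_0_2_0164 hr0 hr1) (fun r hr1 hr2 => innerMomentRaw_high_0_2_0164 hr1 hr2)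
    (by fun_prop) (by fun_prop)
  beta_reduce at h
  rw [h, outerInt_high_0_2_2_0164, outerInt_low_0_2_2_0164]
  ring

/-- **`M_{022}(s)` on `[2,3]`.** [folklore] -/
theorem sectionMoment_0_2_2_three_0164 {s : ℝ} (hs2 : 2 ≤ s) (hs3 : s ≤ 3) :
    sliceIntegral 3 s (fun u : Fin 3 → ℝ => if ∀ k, 0 < u k ∧ u k < 1 then u 0 ^ 0 * u 1 ^ 2 * u 2 ^ 2 else 0) =
      (27 / 20 : ℝ) + (-(21 / 10) : ℝ) * s + (5 / 4 : ℝ) * s ^ 2 + (-(1 / 3) : ℝ) * s ^ 3 + (1 / 12 : ℝ) * s ^ 4 + (-(1 / 30) : ℝ) * s ^ 5 + (1 / 180 : ℝ) * s ^ 6 := by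
  rw [sectionMoment_peel_0164]
  have h := outer_range_three_0164 2 hs2 hs3 (fun r : ℝ => ∫ x in Set.Ioo 0 r, (if (0 < x ∧ x < 1) ∧ (0 < r - x ∧ r - x < 1) then x ^ 0 * (r - x) ^ 2 else 0)) (fun r : ℝ => (2 / 3 : ℝ) + (-1 : ℝ) * r + (1 : ℝ) * r ^ 2 + (-(1 / 3) : ℝ) * r ^ 3)
    (fun r hr1 hr2 => innerMomentRaw_high_0_2_0164 hr1 hr2) (fun r hr2 => inner_window_off_0164 hr2 _)
  beta_reduce at h
  rw [h, outerInt_high_0_2_2_0164]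
  ring

/-- Polynomial antiderivative (generated): `∫ t^0·P(s−t)` for `P = (1 / 2 : ℝ) * r ^ 2`. [folklore] -/
theorem outerInt_low_1_0_0_0164 (s lo hi : ℝ) :
    (∫ t in lo..hi, t ^ 0 * ((1 / 2 : ℝ) * (s - t) ^ 2)) =
      (((1 / 2 : ℝ) * s ^ 2) * hi ^ 1 / 1 + ((-1 : ℝ) * s) * hi ^ 2 / 2 + ((1 / 2 : ℝ)) * hi ^ 3 / 3) -
      (((1 / 2 : ℝ) * s ^ 2) * lo ^ 1 / 1 + ((-1 : ℝ) * s) * lo ^ 2 / 2 + ((1 / 2 : ℝ)) * lo ^ 3 / 3) := by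
  have hderiv : ∀ t : ℝ, HasDerivAt (fun t : ℝ => ((1 / 2 : ℝ) * s ^ 2) * t ^ 1 / 1 + ((-1 : ℝ) * s) * t ^ 2 / 2 + ((1 / 2 : ℝ)) * t ^ 3 / 3)
      (t ^ 0 * ((1 / 2 : ℝ) * (s - t) ^ 2)) t := by
    intro t
    have h0 := ((hasDerivAt_pow 1 t).const_mul ((1 / 2 : ℝ) * s ^ 2)).div_const (1 : ℝ)
    have h1 := ((hasDerivAt_pow 2 t).const_mul ((-1 : ℝ) * s)).div_const (2 : ℝ)
    have h2 := ((hasDerivAt_pow 3 t).const_mul ((1 / 2 : ℝ))).div_const (3 : ℝ)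
    refine ((((h0.add h1).add h2).congr_of_eventuallyEq ?_).congr_deriv ?_)
    · exact Filter.Eventually.of_forall fun y => by simp only [Pi.add_apply]
    · push_cast; try ring
  rw [intervalIntegral.integral_eq_sub_of_hasDerivAt (fun t _ => hderiv t)
    ((by fun_prop : Continuous fun t : ℝ => t ^ 0 * ((1 / 2 : ℝ) * (s - t) ^ 2)).intervalIntegrable _ _)]

/-- Polynomial antiderivative (generated): `∫ t^0·P(s−t)` for `P = (1 : ℝ) * r + (-(1 / 2) : ℝ) * r ^ 2`. [folklore] -/
theorem outerInt_high_1_0_0_0164 (s lo hi : ℝ) :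
    (∫ t in lo..hi, t ^ 0 * ((1 : ℝ) * (s - t) + (-(1 / 2) : ℝ) * (s - t) ^ 2)) =
      (((1 : ℝ) * s + (-(1 / 2) : ℝ) * s ^ 2) * hi ^ 1 / 1 + ((-1 : ℝ) + (1 : ℝ) * s) * hi ^ 2 / 2 + ((-(1 / 2) : ℝ)) * hi ^ 3 / 3) -
      (((1 : ℝ) * s + (-(1 / 2) : ℝ) * s ^ 2) * lo ^ 1 / 1 + ((-1 : ℝ) + (1 : ℝ) * s) * lo ^ 2 / 2 + ((-(1 / 2) : ℝ)) * lo ^ 3 / 3) := by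
  have hderiv : ∀ t : ℝ, HasDerivAt (fun t : ℝ => ((1 : ℝ) * s + (-(1 / 2) : ℝ) * s ^ 2) * t ^ 1 / 1 + ((-1 : ℝ) + (1 : ℝ) * s) * t ^ 2 / 2 + ((-(1 / 2) : ℝ)) * t ^ 3 / 3)
      (t ^ 0 * ((1 : ℝ) * (s - t) + (-(1 / 2) : ℝ) * (s - t) ^ 2)) t := by
    intro t
    have h0 := ((hasDerivAt_pow 1 t).const_mul ((1 : ℝ) * s + (-(1 / 2) : ℝ) * s ^ 2)).div_const (1 : ℝ)
    have h1 := ((hasDerivAt_pow 2 t).const_mul ((-1 : ℝ) + (1 : ℝ) * s)).div_const (2 : ℝ)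
    have h2 := ((hasDerivAt_pow 3 t).const_mul ((-(1 / 2) : ℝ))).div_const (3 : ℝ)
    refine ((((h0.add h1).add h2).congr_of_eventuallyEq ?_).congr_deriv ?_)
    · exact Filter.Eventually.of_forall fun y => by simp only [Pi.add_apply]
    · push_cast; try ring
  rw [intervalIntegral.integral_eq_sub_of_hasDerivAt (fun t _ => hderiv t)
    ((by fun_prop : Continuous fun t : ℝ => t ^ 0 * ((1 : ℝ) * (s - t) + (-(1 / 2) : ℝ) * (s - t) ^ 2)).intervalIntegrable _ _)]

/-- **`M_{100}(s)` on `(0,1]`.** [folklore] -/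
theorem sectionMoment_1_0_0_one_0164 {s : ℝ} (hs0 : 0 < s) (hs1 : s ≤ 1) :
    sliceIntegral 3 s (fun u : Fin 3 → ℝ => if ∀ k, 0 < u k ∧ u k < 1 then u 0 ^ 1 * u 1 ^ 0 * u 2 ^ 0 else 0) =
      (1 / 6 : ℝ) * s ^ 3 := by
  rw [sectionMoment_peel_0164]
  have h := outer_range_one_0164 0 hs0 hs1 (fun r : ℝ => ∫ x in Set.Ioo 0 r, (if (0 < x ∧ x < 1) ∧ (0 < r - x ∧ r - x < 1) then x ^ 1 * (r - x) ^ 0 else 0)) (fun r : ℝ => (1 / 2 : ℝ) * r ^ 2)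
    (fun r hr0 hr1 => innerMomentRaw_low_1_0_0164 hr0 hr1)
  beta_reduce at h
  rw [h, outerInt_low_1_0_0_0164]
  ring

/-- **`M_{100}(s)` on `[1,2)`.** [folklore] -/
theorem sectionMoment_1_0_0_two_0164 {s : ℝ} (hs1 : 1 ≤ s) (hs2 : s < 2) :
    sliceIntegral 3 s (fun u : Fin 3 → ℝ => if ∀ k, 0 < u k ∧ u k < 1 then u 0 ^ 1 * u 1 ^ 0 * u 2 ^ 0 else 0) =
      (-(1 / 2) : ℝ) * s + (1 : ℝ) * s ^ 2 + (-(1 / 3) : ℝ) * s ^ 3 := by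
  rw [sectionMoment_peel_0164]
  have h := outer_range_two_0164 0 hs1 hs2 (fun r : ℝ => ∫ x in Set.Ioo 0 r, (if (0 < x ∧ x < 1) ∧ (0 < r - x ∧ r - x < 1) then x ^ 1 * (r - x) ^ 0 else 0)) (fun r : ℝ => (1 / 2 : ℝ) * r ^ 2) (fun r : ℝ => (1 : ℝ) * r + (-(1 / 2) : ℝ) * r ^ 2)
    (fun r hr0 hr1 => innerMomentRaw_low_1_0_0164 hr0 hr1) (fun r hr1 hr2 => innerMomentRaw_high_1_0_0164 hr1 hr2)
    (by fun_prop) (by fun_prop)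
  beta_reduce at h
  rw [h, outerInt_high_1_0_0_0164, outerInt_low_1_0_0_0164]
  ring

/-- **`M_{100}(s)` on `[2,3]`.** [folklore] -/
theorem sectionMoment_1_0_0_three_0164 {s : ℝ} (hs2 : 2 ≤ s) (hs3 : s ≤ 3) :
    sliceIntegral 3 s (fun u : Fin 3 → ℝ => if ∀ k, 0 < u k ∧ u k < 1 then u 0 ^ 1 * u 1 ^ 0 * u 2 ^ 0 else 0) =
      (3 / 2 : ℝ) * s + (-1 : ℝ) * s ^ 2 + (1 / 6 : ℝ) * s ^ 3 := by
  rw [sectionMoment_peel_0164]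
  have h := outer_range_three_0164 0 hs2 hs3 (fun r : ℝ => ∫ x in Set.Ioo 0 r, (if (0 < x ∧ x < 1) ∧ (0 < r - x ∧ r - x < 1) then x ^ 1 * (r - x) ^ 0 else 0)) (fun r : ℝ => (1 : ℝ) * r + (-(1 / 2) : ℝ) * r ^ 2)
    (fun r hr1 hr2 => innerMomentRaw_high_1_0_0164 hr1 hr2) (fun r hr2 => inner_window_off_0164 hr2 _)
  beta_reduce at h
  rw [h, outerInt_high_1_0_0_0164]
  ring

/-- Polynomial antiderivative (generated): `∫ t^1·P(s−t)` for `P = (1 / 2 : ℝ) * r ^ 2`. [folklore] -/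
theorem outerInt_low_1_0_1_0164 (s lo hi : ℝ) :
    (∫ t in lo..hi, t ^ 1 * ((1 / 2 : ℝ) * (s - t) ^ 2)) =
      (((1 / 2 : ℝ) * s ^ 2) * hi ^ 2 / 2 + ((-1 : ℝ) * s) * hi ^ 3 / 3 + ((1 / 2 : ℝ)) * hi ^ 4 / 4) -
      (((1 / 2 : ℝ) * s ^ 2) * lo ^ 2 / 2 + ((-1 : ℝ) * s) * lo ^ 3 / 3 + ((1 / 2 : ℝ)) * lo ^ 4 / 4) := by
  have hderiv : ∀ t : ℝ, HasDerivAt (fun t : ℝ => ((1 / 2 : ℝ) * s ^ 2) * t ^ 2 / 2 + ((-1 : ℝ) * s) * t ^ 3 / 3 + ((1 / 2 : ℝ)) * t ^ 4 / 4)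
      (t ^ 1 * ((1 / 2 : ℝ) * (s - t) ^ 2)) t := by
    intro t
    have h0 := ((hasDerivAt_pow 2 t).const_mul ((1 / 2 : ℝ) * s ^ 2)).div_const (2 : ℝ)
    have h1 := ((hasDerivAt_pow 3 t).const_mul ((-1 : ℝ) * s)).div_const (3 : ℝ)
    have h2 := ((hasDerivAt_pow 4 t).const_mul ((1 / 2 : ℝ))).div_const (4 : ℝ)
    refine ((((h0.add h1).add h2).congr_of_eventuallyEq ?_).congr_deriv ?_)
    · exact Filter.Eventually.of_forall fun y => by simp only [Pi.add_apply]
    · push_cast; try ring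
  rw [intervalIntegral.integral_eq_sub_of_hasDerivAt (fun t _ => hderiv t)
    ((by fun_prop : Continuous fun t : ℝ => t ^ 1 * ((1 / 2 : ℝ) * (s - t) ^ 2)).intervalIntegrable _ _)]

/-- Polynomial antiderivative (generated): `∫ t^1·P(s−t)` for `P = (1 : ℝ) * r + (-(1 / 2) : ℝ) * r ^ 2`. [folklore] -/
theorem outerInt_high_1_0_1_0164 (s lo hi : ℝ) :
    (∫ t in lo..hi, t ^ 1 * ((1 : ℝ) * (s - t) + (-(1 / 2) : ℝ) * (s - t) ^ 2)) =
      (((1 : ℝ) * s + (-(1 / 2) : ℝ) * s ^ 2) * hi ^ 2 / 2 + ((-1 : ℝ) + (1 : ℝ) * s) * hi ^ 3 / 3 + ((-(1 / 2) : ℝ)) * hi ^ 4 / 4) -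
      (((1 : ℝ) * s + (-(1 / 2) : ℝ) * s ^ 2) * lo ^ 2 / 2 + ((-1 : ℝ) + (1 : ℝ) * s) * lo ^ 3 / 3 + ((-(1 / 2) : ℝ)) * lo ^ 4 / 4) := by
  have hderiv : ∀ t : ℝ, HasDerivAt (fun t : ℝ => ((1 : ℝ) * s + (-(1 / 2) : ℝ) * s ^ 2) * t ^ 2 / 2 + ((-1 : ℝ) + (1 : ℝ) * s) * t ^ 3 / 3 + ((-(1 / 2) : ℝ)) * t ^ 4 / 4)
      (t ^ 1 * ((1 : ℝ) * (s - t) + (-(1 / 2) : ℝ) * (s - t) ^ 2)) t := by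
    intro t
    have h0 := ((hasDerivAt_pow 2 t).const_mul ((1 : ℝ) * s + (-(1 / 2) : ℝ) * s ^ 2)).div_const (2 : ℝ)
    have h1 := ((hasDerivAt_pow 3 t).const_mul ((-1 : ℝ) + (1 : ℝ) * s)).div_const (3 : ℝ)
    have h2 := ((hasDerivAt_pow 4 t).const_mul ((-(1 / 2) : ℝ))).div_const (4 : ℝ)
    refine ((((h0.add h1).add h2).congr_of_eventuallyEq ?_).congr_deriv ?_)
    · exact Filter.Eventually.of_forall fun y => by simp only [Pi.add_apply]
    · push_cast; try ring
  rw [intervalIntegral.integral_eq_sub_of_hasDerivAt (fun t _ => hderiv t)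
    ((by fun_prop : Continuous fun t : ℝ => t ^ 1 * ((1 : ℝ) * (s - t) + (-(1 / 2) : ℝ) * (s - t) ^ 2)).intervalIntegrable _ _)]

/-- **`M_{101}(s)` on `(0,1]`.** [folklore] -/
theorem sectionMoment_1_0_1_one_0164 {s : ℝ} (hs0 : 0 < s) (hs1 : s ≤ 1) :
    sliceIntegral 3 s (fun u : Fin 3 → ℝ => if ∀ k, 0 < u k ∧ u k < 1 then u 0 ^ 1 * u 1 ^ 0 * u 2 ^ 1 else 0) =
      (1 / 24 : ℝ) * s ^ 4 := by
  rw [sectionMoment_peel_0164]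
  have h := outer_range_one_0164 1 hs0 hs1 (fun r : ℝ => ∫ x in Set.Ioo 0 r, (if (0 < x ∧ x < 1) ∧ (0 < r - x ∧ r - x < 1) then x ^ 1 * (r - x) ^ 0 else 0)) (fun r : ℝ => (1 / 2 : ℝ) * r ^ 2)
    (fun r hr0 hr1 => innerMomentRaw_low_1_0_0164 hr0 hr1)
  beta_reduce at h
  rw [h, outerInt_low_1_0_1_0164]
  ring

/-- **`M_{101}(s)` on `[1,2)`.** [folklore] -/
theorem sectionMoment_1_0_1_two_0164 {s : ℝ} (hs1 : 1 ≤ s) (hs2 : s < 2) :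
    sliceIntegral 3 s (fun u : Fin 3 → ℝ => if ∀ k, 0 < u k ∧ u k < 1 then u 0 ^ 1 * u 1 ^ 0 * u 2 ^ 1 else 0) =
      (5 / 24 : ℝ) + (-(1 / 2) : ℝ) * s + (1 / 4 : ℝ) * s ^ 2 + (1 / 6 : ℝ) * s ^ 3 + (-(1 / 12) : ℝ) * s ^ 4 := by
  rw [sectionMoment_peel_0164]
  have h := outer_range_two_0164 1 hs1 hs2 (fun r : ℝ => ∫ x in Set.Ioo 0 r, (if (0 < x ∧ x < 1) ∧ (0 < r - x ∧ r - x < 1) then x ^ 1 * (r - x) ^ 0 else 0)) (fun r : ℝ => (1 / 2 : ℝ) * r ^ 2) (fun r : ℝ => (1 : ℝ) * r + (-(1 / 2) : ℝ) * r ^ 2)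
    (fun r hr0 hr1 => innerMomentRaw_low_1_0_0164 hr0 hr1) (fun r hr1 hr2 => innerMomentRaw_high_1_0_0164 hr1 hr2)
    (by fun_prop) (by fun_prop)
  beta_reduce at h
  rw [h, outerInt_high_1_0_1_0164, outerInt_low_1_0_1_0164]
  ring

/-- **`M_{101}(s)` on `[2,3]`.** [folklore] -/
theorem sectionMoment_1_0_1_three_0164 {s : ℝ} (hs2 : 2 ≤ s) (hs3 : s ≤ 3) :
    sliceIntegral 3 s (fun u : Fin 3 → ℝ => if ∀ k, 0 < u k ∧ u k < 1 then u 0 ^ 1 * u 1 ^ 0 * u 2 ^ 1 else 0) =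
      (-(9 / 8) : ℝ) + (3 / 2 : ℝ) * s + (-(1 / 4) : ℝ) * s ^ 2 + (-(1 / 6) : ℝ) * s ^ 3 + (1 / 24 : ℝ) * s ^ 4 := by
  rw [sectionMoment_peel_0164]
  have h := outer_range_three_0164 1 hs2 hs3 (fun r : ℝ => ∫ x in Set.Ioo 0 r, (if (0 < x ∧ x < 1) ∧ (0 < r - x ∧ r - x < 1) then x ^ 1 * (r - x) ^ 0 else 0)) (fun r : ℝ => (1 : ℝ) * r + (-(1 / 2) : ℝ) * r ^ 2)
    (fun r hr1 hr2 => innerMomentRaw_high_1_0_0164 hr1 hr2) (fun r hr2 => inner_window_off_0164 hr2 _)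
  beta_reduce at h
  rw [h, outerInt_high_1_0_1_0164]
  ring

/-- Polynomial antiderivative (generated): `∫ t^2·P(s−t)` for `P = (1 / 2 : ℝ) * r ^ 2`. [folklore] -/
theorem outerInt_low_1_0_2_0164 (s lo hi : ℝ) :
    (∫ t in lo..hi, t ^ 2 * ((1 / 2 : ℝ) * (s - t) ^ 2)) =
      (((1 / 2 : ℝ) * s ^ 2) * hi ^ 3 / 3 + ((-1 : ℝ) * s) * hi ^ 4 / 4 + ((1 / 2 : ℝ)) * hi ^ 5 / 5) -
      (((1 / 2 : ℝ) * s ^ 2) * lo ^ 3 / 3 + ((-1 : ℝ) * s) * lo ^ 4 / 4 + ((1 / 2 : ℝ)) * lo ^ 5 / 5) := by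
  have hderiv : ∀ t : ℝ, HasDerivAt (fun t : ℝ => ((1 / 2 : ℝ) * s ^ 2) * t ^ 3 / 3 + ((-1 : ℝ) * s) * t ^ 4 / 4 + ((1 / 2 : ℝ)) * t ^ 5 / 5)
      (t ^ 2 * ((1 / 2 : ℝ) * (s - t) ^ 2)) t := by
    intro t
    have h0 := ((hasDerivAt_pow 3 t).const_mul ((1 / 2 : ℝ) * s ^ 2)).div_const (3 : ℝ)
    have h1 := ((hasDerivAt_pow 4 t).const_mul ((-1 : ℝ) * s)).div_const (4 : ℝ)
    have h2 := ((hasDerivAt_pow 5 t).const_mul ((1 / 2 : ℝ))).div_const (5 : ℝ)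
    refine ((((h0.add h1).add h2).congr_of_eventuallyEq ?_).congr_deriv ?_)
    · exact Filter.Eventually.of_forall fun y => by simp only [Pi.add_apply]
    · push_cast; try ring
  rw [intervalIntegral.integral_eq_sub_of_hasDerivAt (fun t _ => hderiv t)
    ((by fun_prop : Continuous fun t : ℝ => t ^ 2 * ((1 / 2 : ℝ) * (s - t) ^ 2)).intervalIntegrable _ _)]

/-- Polynomial antiderivative (generated): `∫ t^2·P(s−t)` for `P = (1 : ℝ) * r + (-(1 / 2) : ℝ) * r ^ 2`. [folklore] -/
theorem outerInt_high_1_0_2_0164 (s lo hi : ℝ) :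
    (∫ t in lo..hi, t ^ 2 * ((1 : ℝ) * (s - t) + (-(1 / 2) : ℝ) * (s - t) ^ 2)) =
      (((1 : ℝ) * s + (-(1 / 2) : ℝ) * s ^ 2) * hi ^ 3 / 3 + ((-1 : ℝ) + (1 : ℝ) * s) * hi ^ 4 / 4 + ((-(1 / 2) : ℝ)) * hi ^ 5 / 5) -
      (((1 : ℝ) * s + (-(1 / 2) : ℝ) * s ^ 2) * lo ^ 3 / 3 + ((-1 : ℝ) + (1 : ℝ) * s) * lo ^ 4 / 4 + ((-(1 / 2) : ℝ)) * lo ^ 5 / 5) := by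
  have hderiv : ∀ t : ℝ, HasDerivAt (fun t : ℝ => ((1 : ℝ) * s + (-(1 / 2) : ℝ) * s ^ 2) * t ^ 3 / 3 + ((-1 : ℝ) + (1 : ℝ) * s) * t ^ 4 / 4 + ((-(1 / 2) : ℝ)) * t ^ 5 / 5)
      (t ^ 2 * ((1 : ℝ) * (s - t) + (-(1 / 2) : ℝ) * (s - t) ^ 2)) t := by
    intro t
    have h0 := ((hasDerivAt_pow 3 t).const_mul ((1 : ℝ) * s + (-(1 / 2) : ℝ) * s ^ 2)).div_const (3 : ℝ)
    have h1 := ((hasDerivAt_pow 4 t).const_mul ((-1 : ℝ) + (1 : ℝ) * s)).div_const (4 : ℝ)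
    have h2 := ((hasDerivAt_pow 5 t).const_mul ((-(1 / 2) : ℝ))).div_const (5 : ℝ)
    refine ((((h0.add h1).add h2).congr_of_eventuallyEq ?_).congr_deriv ?_)
    · exact Filter.Eventually.of_forall fun y => by simp only [Pi.add_apply]
    · push_cast; try ring
  rw [intervalIntegral.integral_eq_sub_of_hasDerivAt (fun t _ => hderiv t)
    ((by fun_prop : Continuous fun t : ℝ => t ^ 2 * ((1 : ℝ) * (s - t) + (-(1 / 2) : ℝ) * (s - t) ^ 2)).intervalIntegrable _ _)]

/-- **`M_{102}(s)` on `(0,1]`.** [folklore] -/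
theorem sectionMoment_1_0_2_one_0164 {s : ℝ} (hs0 : 0 < s) (hs1 : s ≤ 1) :
    sliceIntegral 3 s (fun u : Fin 3 → ℝ => if ∀ k, 0 < u k ∧ u k < 1 then u 0 ^ 1 * u 1 ^ 0 * u 2 ^ 2 else 0) =
      (1 / 60 : ℝ) * s ^ 5 := by
  rw [sectionMoment_peel_0164]
  have h := outer_range_one_0164 2 hs0 hs1 (fun r : ℝ => ∫ x in Set.Ioo 0 r, (if (0 < x ∧ x < 1) ∧ (0 < r - x ∧ r - x < 1) then x ^ 1 * (r - x) ^ 0 else 0)) (fun r : ℝ => (1 / 2 : ℝ) * r ^ 2)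
    (fun r hr0 hr1 => innerMomentRaw_low_1_0_0164 hr0 hr1)
  beta_reduce at h
  rw [h, outerInt_low_1_0_2_0164]
  ring

/-- **`M_{102}(s)` on `[1,2)`.** [folklore] -/
theorem sectionMoment_1_0_2_two_0164 {s : ℝ} (hs1 : 1 ≤ s) (hs2 : s < 2) :
    sliceIntegral 3 s (fun u : Fin 3 → ℝ => if ∀ k, 0 < u k ∧ u k < 1 then u 0 ^ 1 * u 1 ^ 0 * u 2 ^ 2 else 0) =
      (1 / 20 : ℝ) + (-(1 / 12) : ℝ) * s + (1 / 12 : ℝ) * s ^ 4 + (-(1 / 30) : ℝ) * s ^ 5 := by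
  rw [sectionMoment_peel_0164]
  have h := outer_range_two_0164 2 hs1 hs2 (fun r : ℝ => ∫ x in Set.Ioo 0 r, (if (0 < x ∧ x < 1) ∧ (0 < r - x ∧ r - x < 1) then x ^ 1 * (r - x) ^ 0 else 0)) (fun r : ℝ => (1 / 2 : ℝ) * r ^ 2) (fun r : ℝ => (1 : ℝ) * r + (-(1 / 2) : ℝ) * r ^ 2)
    (fun r hr0 hr1 => innerMomentRaw_low_1_0_0164 hr0 hr1) (fun r hr1 hr2 => innerMomentRaw_high_1_0_0164 hr1 hr2)
    (by fun_prop) (by fun_prop)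
  beta_reduce at h
  rw [h, outerInt_high_1_0_2_0164, outerInt_low_1_0_2_0164]
  ring

/-- **`M_{102}(s)` on `[2,3]`.** [folklore] -/
theorem sectionMoment_1_0_2_three_0164 {s : ℝ} (hs2 : 2 ≤ s) (hs3 : s ≤ 3) :
    sliceIntegral 3 s (fun u : Fin 3 → ℝ => if ∀ k, 0 < u k ∧ u k < 1 then u 0 ^ 1 * u 1 ^ 0 * u 2 ^ 2 else 0) =
      (9 / 20 : ℝ) + (-(3 / 4) : ℝ) * s + (1 / 2 : ℝ) * s ^ 2 + (-(1 / 12) : ℝ) * s ^ 4 + (1 / 60 : ℝ) * s ^ 5 := by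
  rw [sectionMoment_peel_0164]
  have h := outer_range_three_0164 2 hs2 hs3 (fun r : ℝ => ∫ x in Set.Ioo 0 r, (if (0 < x ∧ x < 1) ∧ (0 < r - x ∧ r - x < 1) then x ^ 1 * (r - x) ^ 0 else 0)) (fun r : ℝ => (1 : ℝ) * r + (-(1 / 2) : ℝ) * r ^ 2)
    (fun r hr1 hr2 => innerMomentRaw_high_1_0_0164 hr1 hr2) (fun r hr2 => inner_window_off_0164 hr2 _)
  beta_reduce at h
  rw [h, outerInt_high_1_0_2_0164]
  ring
end Summit.Parity.GeneralizedHardyLittlewood.FordMaynardNoSieveConst0164NegWitness0164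

end
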